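import Mathlib
import Literature.AlgebraicGeometry.Resolution.CobordantGame
import Literature.AlgebraicGeometry.Resolution.CobordantChartCoefficients
import Literature.AlgebraicGeometry.Resolution.CobordantTupleGame
import Literature.AlgebraicGeometry.Resolution.FormalCoordinateChange
import Summits.ResolutionOfSingularities.ResolutionOfSingularities.Theorems.WeightedInvariantGlobalizeLocalDropCanonize
import Summits.ResolutionOfSingularities.ResolutionOfSingularities.Theorems.WeightedInvariantLocalWeightedDropMonicPointBlowup
import Summits.ResolutionOfSingularities.ResolutionOfSingularities.Theorems.WeightedInvariantLocalWeightedDropMonicCurveBlowup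
import Summits.ResolutionOfSingularities.ResolutionOfSingularities.Theorems.WeightedInvariantLocalWeightedDropCharTwoDoublePointReduction

/-!
# `WeightedInvariant.LocalWeightedDrop`, line `hasse-ridge-face-selection`: the LIFT for monic forms of any degree (N3)

Crux item stmt-ResolutionOfSingularities-8899 `LocalWeightedDrop` (route `ResolutionOfSingularities/WeightedInvariant`),
serving the door `WeightedConstruction` stmt-ResolutionOfSingularities-0571.  [OURS · L1 W4.3, chain w43, stub worker 3:
helper N3 of CRUX-PLAN w43 §3C in every degree `d`, for S2 `stub_charTwoDoublePointSurfaceWon` (`d = 2`) and S3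
`stub_wildUnaryConeSurfaceWon` (`p ∣ d ≥ 3`) of skeleton v19.  Not a statement of any manuscript.]

`monicFormsWon_of_rank` (every characteristic `p`, every dimension `m + 1`, every degree `d ≥ 1`): POSITIONS are the monic forms
`P(A) = y^d + Σ_{j<d} A_j(x') y^j` with `ord A_j > d - j` (`WeierstrassForm.exists_monicForm`); the EXITS are an arbitrary
caller-supplied predicate `E` on germs together with a proof that singular germs satisfying `E` are won (for `d = 2`: the
hyperbolic quadric, `TangentConeCut.hyperbolicStartsWon`; for `d ≥ 3`: order drop / apex-free cone
`TangentConeCut.apexFreeStartsWon` / the axis hypothesis of S3 rev c); MOVES: the rank player first applies ANY legal coordinate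
change `θ` carrying the position to another position (`P(A) ∘ θ = P(B)` — typically the re-centring `y ↦ y + φ(x')`, whose
identity the rank player supplies), then the point blow-up (`won_monic_of_pointBlowup`) or a permissible curve blow-up
(`won_monic_of_curveBlowup`).  THE THEOREM: an ordinal rank `κ` on positions with the STEP PROPERTY — every singular slice of
the chosen brick is an exit or re-normalises (`S ∘ M = H · P(A')`, data supplied by the rank player) to a position of smaller
rank — wins every position.  Proof: well-founded induction on `κ` (`won_subst_iff`, `won_unit_mul_iff`, the two bricks).
The `d = 2` specialisation with the re-centring brick spelled out is `monicDoublePointsWon_of_rank`.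
-/

set_option linter.dupNamespace false -- mandated namespace of this single-conjunct summit

namespace Summit.ResolutionOfSingularities.ResolutionOfSingularities.Theorems

open Literature.AlgebraicGeometry.Resolution
open Literature.AlgebraicGeometry.Resolution.CobordantGame

open MvPowerSeries in
/-- N3 — THE LIFT FOR MONIC FORMS OF DEGREE `d` (see the module docstring): a rank with the step property wins every position. -/
theorem monicFormsWon_of_rank (p : ℕ) (hp : p.Prime) (k : Type) [Field k] [CharP k p] (m d : ℕ) (hd : 0 < d)
    (E : MvPowerSeries (Fin (m + 1)) k → Prop)
    (hE : ∀ S : MvPowerSeries (Fin (m + 1)) k, CobordantGame.IsSingular k S → E S → CobordantGame.Won k (m + 1) S)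
    (κ : (Fin d → MvPowerSeries (Fin m) k) → Ordinal.{0})
    (hstep : ∀ A : Fin d → MvPowerSeries (Fin m) k, (∀ j : Fin d, ((d - (j : ℕ) : ℕ) : ℕ∞) < (A j).order) →
      ∃ (θ : Fin (m + 1) → MvPowerSeries (Fin (m + 1)) k) (B : Fin d → MvPowerSeries (Fin m) k),
        (∀ i, MvPowerSeries.constantCoeff (θ i) = 0) ∧
        IsUnit (Matrix.det (Matrix.of fun i j => MvPowerSeries.coeff (Finsupp.single j 1) (θ i))) ∧
        MvPowerSeries.subst θ (MvPowerSeries.X (Fin.last m) ^ d +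
            ∑ j : Fin d, MvPowerSeries.rename (Fin.succAboveEmb (Fin.last m)) (A j) * MvPowerSeries.X (Fin.last m) ^ (j : ℕ)) =
          MvPowerSeries.X (Fin.last m) ^ d +
            ∑ j : Fin d, MvPowerSeries.rename (Fin.succAboveEmb (Fin.last m)) (B j) * MvPowerSeries.X (Fin.last m) ^ (j : ℕ) ∧
        (∀ j : Fin d, ((d - (j : ℕ) : ℕ) : ℕ∞) < (B j).order) ∧
        let good : MvPowerSeries (Fin (m + 1)) k → Prop := fun S =>
          E S ∨
          (∃ (M : Matrix (Fin (m + 1)) (Fin (m + 1)) k) (H : MvPowerSeries (Fin (m + 1)) k)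
              (A' : Fin d → MvPowerSeries (Fin m) k),
            IsUnit M.det ∧ MvPowerSeries.constantCoeff H ≠ 0 ∧ (∀ j : Fin d, ((d - (j : ℕ) : ℕ) : ℕ∞) < (A' j).order) ∧
            MvPowerSeries.subst (FormalCoordChange.linSubst M) S =
              H * (MvPowerSeries.X (Fin.last m) ^ d +
                ∑ j : Fin d, MvPowerSeries.rename (Fin.succAboveEmb (Fin.last m)) (A' j) * MvPowerSeries.X (Fin.last m) ^ (j : ℕ)) ∧
            κ A' < κ A)
        ((∀ (c : Fin m → k) (i₀ : Fin m), c i₀ ≠ 0 → ∀ Bv : Fin d → MvPowerSeries (Fin (m + 1)) k,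
            (∀ j : Fin d, MvPowerSeries.subst (CobordantChart.chart (fun _ : Fin m => 1) c) (B j) =
              MvPowerSeries.X 0 ^ (d - (j : ℕ) + 1) * Bv j) →
            ∀ S : MvPowerSeries (Fin (m + 1)) k, S = MvPowerSeries.X (Fin.last m) ^ d +
              ∑ j : Fin d, MvPowerSeries.rename (Fin.succAboveEmb (Fin.last m))
                (TupleGame.slice i₀ (MvPowerSeries.X 0 * Bv j)) * MvPowerSeries.X (Fin.last m) ^ (j : ℕ) →
            CobordantGame.IsSingular k S → good S) ∨
         (∃ (i : Fin m) (A'' : Fin d → MvPowerSeries (Fin m) k),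
            (∀ j : Fin d, B j = MvPowerSeries.X i ^ (d - (j : ℕ)) * A'' j) ∧
            (∀ j : Fin d, MvPowerSeries.constantCoeff (A'' j) = 0) ∧
            ∀ ci : k, ci ≠ 0 → ∀ S : MvPowerSeries (Fin (m + 1)) k, S = MvPowerSeries.X (Fin.last m) ^ d +
              ∑ j : Fin d, MvPowerSeries.rename (Fin.succAboveEmb (Fin.last m))
                (MvPowerSeries.C (ci ^ (d - (j : ℕ))) * TupleGame.slice i
                  (MvPowerSeries.subst (CobordantChart.chart (fun l : Fin m => if l = i then 1 else 0)
                    (fun l : Fin m => if l = i then ci else 0)) (A'' j))) *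
                MvPowerSeries.X (Fin.last m) ^ (j : ℕ) →
              CobordantGame.IsSingular k S → good S))) :
    ∀ A : Fin d → MvPowerSeries (Fin m) k, (∀ j : Fin d, ((d - (j : ℕ) : ℕ) : ℕ∞) < (A j).order) →
      CobordantGame.Won k (m + 1) (MvPowerSeries.X (Fin.last m) ^ d +
        ∑ j : Fin d, MvPowerSeries.rename (Fin.succAboveEmb (Fin.last m)) (A j) * MvPowerSeries.X (Fin.last m) ^ (j : ℕ)) := by
  classical
  suffices key : ∀ (α : Ordinal.{0}) (A : Fin d → MvPowerSeries (Fin m) k), κ A = α →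
      (∀ j : Fin d, ((d - (j : ℕ) : ℕ) : ℕ∞) < (A j).order) →
      Won k (m + 1) (X (Fin.last m) ^ d +
        ∑ j : Fin d, rename (Fin.succAboveEmb (Fin.last m)) (A j) * X (Fin.last m) ^ (j : ℕ)) from
    fun A hA => key _ A rfl hA
  intro α
  induction α using WellFoundedLT.induction with
  | ind α ih =>
  intro A hα hA
  obtain ⟨θ, B, hθ0, hθdet, hθP, hB, hbr⟩ := hstep A hA
  -- move to the position `B` along `θ`
  rw [← won_subst_iff hθ0 hθdet, hθP]
  -- a good singular slice is won
  have hgood : ∀ S : MvPowerSeries (Fin (m + 1)) k, IsSingular k S →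
      (E S ∨
        (∃ (M : Matrix (Fin (m + 1)) (Fin (m + 1)) k) (H : MvPowerSeries (Fin (m + 1)) k)
            (A' : Fin d → MvPowerSeries (Fin m) k),
          IsUnit M.det ∧ constantCoeff H ≠ 0 ∧ (∀ j : Fin d, ((d - (j : ℕ) : ℕ) : ℕ∞) < (A' j).order) ∧
          subst (FormalCoordChange.linSubst M) S = H * (X (Fin.last m) ^ d +
            ∑ j : Fin d, rename (Fin.succAboveEmb (Fin.last m)) (A' j) * X (Fin.last m) ^ (j : ℕ)) ∧
          κ A' < κ A)) →
      Won k (m + 1) S := by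
    intro S hS hgoodS
    rcases hgoodS with hES | ⟨M, H, A', hMdet, hH, hA', hSeq, hlt⟩
    · exact hE S hS hES
    · have hW' := ih _ (hα ▸ hlt) A' rfl hA'
      have hW : Won k (m + 1) (subst (FormalCoordChange.linSubst M) S) := by
        rw [hSeq]
        exact (won_unit_mul_iff hH _).mpr hW'
      exact (won_subst_iff (ConeDichotomy.constantCoeff_linSubst M)
        (by rw [CharTwoDoublePoint.linMat_linSubst]; exact hMdet) S).mp hW
  rcases hbr with hpoint | ⟨i, A'', hdiv, hA''0, hcurve⟩
  · -- the point blow-up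
    refine won_monic_of_pointBlowup p hp k m d hd B hB fun c i₀ hc Bv hBv hSs => ?_
    exact hgood _ hSs (hpoint c i₀ hc Bv hBv _ rfl hSs)
  · -- the curve blow-up along `V(x_i, y)`
    refine won_monic_of_curveBlowup p hp k m d hd i B A'' hdiv hA''0 fun ci hci hSs => ?_
    exact hgood _ hSs (hcurve ci hci _ rfl hSs)


open MvPowerSeries in
/-- N3 RELATIVE TO A CLASS OF POSITIONS — the same lift for a predicate `Q` on positions closed under the steps: if `κ` has
the step property on the `Q`-positions only, and every re-normalised successor named by the rank player is again a
`Q`-position, then every `Q`-position is won.  (For partial results — sub-classes of double points won — and for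
examples; `monicFormsWon_of_rank` is the case `Q = ⊤`.) -/
theorem monicFormsWon_of_rankOn (p : ℕ) (hp : p.Prime) (k : Type) [Field k] [CharP k p] (m d : ℕ) (hd : 0 < d)
    (Q : (Fin d → MvPowerSeries (Fin m) k) → Prop)
    (E : MvPowerSeries (Fin (m + 1)) k → Prop)
    (hE : ∀ S : MvPowerSeries (Fin (m + 1)) k, CobordantGame.IsSingular k S → E S → CobordantGame.Won k (m + 1) S)
    (κ : (Fin d → MvPowerSeries (Fin m) k) → Ordinal.{0})
    (hstep : ∀ A : Fin d → MvPowerSeries (Fin m) k, Q A → (∀ j : Fin d, ((d - (j : ℕ) : ℕ) : ℕ∞) < (A j).order) →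
      ∃ (θ : Fin (m + 1) → MvPowerSeries (Fin (m + 1)) k) (B : Fin d → MvPowerSeries (Fin m) k),
        (∀ i, MvPowerSeries.constantCoeff (θ i) = 0) ∧
        IsUnit (Matrix.det (Matrix.of fun i j => MvPowerSeries.coeff (Finsupp.single j 1) (θ i))) ∧
        MvPowerSeries.subst θ (MvPowerSeries.X (Fin.last m) ^ d +
            ∑ j : Fin d, MvPowerSeries.rename (Fin.succAboveEmb (Fin.last m)) (A j) * MvPowerSeries.X (Fin.last m) ^ (j : ℕ)) =
          MvPowerSeries.X (Fin.last m) ^ d +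
            ∑ j : Fin d, MvPowerSeries.rename (Fin.succAboveEmb (Fin.last m)) (B j) * MvPowerSeries.X (Fin.last m) ^ (j : ℕ) ∧
        (∀ j : Fin d, ((d - (j : ℕ) : ℕ) : ℕ∞) < (B j).order) ∧
        let good : MvPowerSeries (Fin (m + 1)) k → Prop := fun S =>
          E S ∨
          (∃ (M : Matrix (Fin (m + 1)) (Fin (m + 1)) k) (H : MvPowerSeries (Fin (m + 1)) k)
              (A' : Fin d → MvPowerSeries (Fin m) k),
            IsUnit M.det ∧ MvPowerSeries.constantCoeff H ≠ 0 ∧ Q A' ∧ (∀ j : Fin d, ((d - (j : ℕ) : ℕ) : ℕ∞) < (A' j).order) ∧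
            MvPowerSeries.subst (FormalCoordChange.linSubst M) S =
              H * (MvPowerSeries.X (Fin.last m) ^ d +
                ∑ j : Fin d, MvPowerSeries.rename (Fin.succAboveEmb (Fin.last m)) (A' j) * MvPowerSeries.X (Fin.last m) ^ (j : ℕ)) ∧
            κ A' < κ A)
        ((∀ (c : Fin m → k) (i₀ : Fin m), c i₀ ≠ 0 → ∀ Bv : Fin d → MvPowerSeries (Fin (m + 1)) k,
            (∀ j : Fin d, MvPowerSeries.subst (CobordantChart.chart (fun _ : Fin m => 1) c) (B j) =
              MvPowerSeries.X 0 ^ (d - (j : ℕ) + 1) * Bv j) →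
            ∀ S : MvPowerSeries (Fin (m + 1)) k, S = MvPowerSeries.X (Fin.last m) ^ d +
              ∑ j : Fin d, MvPowerSeries.rename (Fin.succAboveEmb (Fin.last m))
                (TupleGame.slice i₀ (MvPowerSeries.X 0 * Bv j)) * MvPowerSeries.X (Fin.last m) ^ (j : ℕ) →
            CobordantGame.IsSingular k S → good S) ∨
         (∃ (i : Fin m) (A'' : Fin d → MvPowerSeries (Fin m) k),
            (∀ j : Fin d, B j = MvPowerSeries.X i ^ (d - (j : ℕ)) * A'' j) ∧
            (∀ j : Fin d, MvPowerSeries.constantCoeff (A'' j) = 0) ∧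
            ∀ ci : k, ci ≠ 0 → ∀ S : MvPowerSeries (Fin (m + 1)) k, S = MvPowerSeries.X (Fin.last m) ^ d +
              ∑ j : Fin d, MvPowerSeries.rename (Fin.succAboveEmb (Fin.last m))
                (MvPowerSeries.C (ci ^ (d - (j : ℕ))) * TupleGame.slice i
                  (MvPowerSeries.subst (CobordantChart.chart (fun l : Fin m => if l = i then 1 else 0)
                    (fun l : Fin m => if l = i then ci else 0)) (A'' j))) *
                MvPowerSeries.X (Fin.last m) ^ (j : ℕ) →
              CobordantGame.IsSingular k S → good S))) :
    ∀ A : Fin d → MvPowerSeries (Fin m) k, Q A → (∀ j : Fin d, ((d - (j : ℕ) : ℕ) : ℕ∞) < (A j).order) →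
      CobordantGame.Won k (m + 1) (MvPowerSeries.X (Fin.last m) ^ d +
        ∑ j : Fin d, MvPowerSeries.rename (Fin.succAboveEmb (Fin.last m)) (A j) * MvPowerSeries.X (Fin.last m) ^ (j : ℕ)) := by
  classical
  suffices key : ∀ (α : Ordinal.{0}) (A : Fin d → MvPowerSeries (Fin m) k), κ A = α → Q A →
      (∀ j : Fin d, ((d - (j : ℕ) : ℕ) : ℕ∞) < (A j).order) →
      Won k (m + 1) (X (Fin.last m) ^ d +
        ∑ j : Fin d, rename (Fin.succAboveEmb (Fin.last m)) (A j) * X (Fin.last m) ^ (j : ℕ)) from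
    fun A hQ hA => key _ A rfl hQ hA
  intro α
  induction α using WellFoundedLT.induction with
  | ind α ih =>
  intro A hα hQ hA
  obtain ⟨θ, B, hθ0, hθdet, hθP, hB, hbr⟩ := hstep A hQ hA
  rw [← won_subst_iff hθ0 hθdet, hθP]
  have hgood : ∀ S : MvPowerSeries (Fin (m + 1)) k, IsSingular k S →
      (E S ∨
        (∃ (M : Matrix (Fin (m + 1)) (Fin (m + 1)) k) (H : MvPowerSeries (Fin (m + 1)) k)
            (A' : Fin d → MvPowerSeries (Fin m) k),
          IsUnit M.det ∧ constantCoeff H ≠ 0 ∧ Q A' ∧ (∀ j : Fin d, ((d - (j : ℕ) : ℕ) : ℕ∞) < (A' j).order) ∧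
          subst (FormalCoordChange.linSubst M) S = H * (X (Fin.last m) ^ d +
            ∑ j : Fin d, rename (Fin.succAboveEmb (Fin.last m)) (A' j) * X (Fin.last m) ^ (j : ℕ)) ∧
          κ A' < κ A)) →
      Won k (m + 1) S := by
    intro S hS hgoodS
    rcases hgoodS with hES | ⟨M, H, A', hMdet, hH, hQ', hA', hSeq, hlt⟩
    · exact hE S hS hES
    · have hW' := ih _ (hα ▸ hlt) A' rfl hQ' hA'
      have hW : Won k (m + 1) (subst (FormalCoordChange.linSubst M) S) := by
        rw [hSeq]
        exact (won_unit_mul_iff hH _).mpr hW'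
      exact (won_subst_iff (ConeDichotomy.constantCoeff_linSubst M)
        (by rw [CharTwoDoublePoint.linMat_linSubst]; exact hMdet) S).mp hW
  rcases hbr with hpoint | ⟨i, A'', hdiv, hA''0, hcurve⟩
  · refine won_monic_of_pointBlowup p hp k m d hd B hB fun c i₀ hc Bv hBv hSs => ?_
    exact hgood _ hSs (hpoint c i₀ hc Bv hBv _ rfl hSs)
  · refine won_monic_of_curveBlowup p hp k m d hd i B A'' hdiv hA''0 fun ci hci hSs => ?_
    exact hgood _ hSs (hcurve ci hci _ rfl hSs)

end Summit.ResolutionOfSingularities.ResolutionOfSingularities.Theorems
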